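import Literature.Barriers.AtomisticToContinuum.OneDimensionalHardCoreRodsLenard
import HarnessLib

/-!
# Hard rods, Part D′: Girardeau's sign trick with shifts

`Literature/Barriers/AtomisticToContinuum/` (D-0021 barrier catalogue), sub-problem
`BoseEinsteinCondensation`; part of the typed proof of the rod barrier `OneDimensionalHardRods`
(`OneDimensionalHardCoreRods.lean`, eighth audit of `OneDimensionalHardCore`, 2026-08-16).

Step (2) of the paper proof, pointwise. On the compressed ring `[0, L']` put the tagged particle at
`0` and again at `t`, let the spectators `w_j` lie in the compressed domain
`D_t = [0, t−a] ∪ (t, L']` (`rodDomain`), and let `T_t` translate the crossed ones (`w_j ≤ t − a`)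
by the rod length `a` (`rodShift`). Then the product of the two free-fermion (Vandermonde)
determinants is a CONSTANT phase times a non-negative function once the crossed spectators carry
the one-body weight `σ = −e^{iπna/L'}` (`rodWeight`):

`∏_j σ(w_j) · det V(e(0), e(w)) · conj det V(e(t), e(T_t w))`
`  = e^{−iπnt/L'} · (n+1)! L'^{n+1} · Ψ_TG(w, 0) Ψ_TG(T_t w, t)`

(`rod_sgn_det_det_eq_girardeau`, the rod version of Part D's `sgn_det_det_eq_girardeau`). The
mechanism: for every PAIR of particles the factor `(e_k − e_j) conj(e'_k − e'_j)` equals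
`s_j s_k |e_k − e_j| |e'_k − e'_j|` with `s = conj(h)` on crossed and `s = 1` on uncrossed particles,
`h = e^{iπa/L'}` (`rod_pair_factor`; only the mixed crossed/uncrossed pairs need a sign analysis,
which is where the empty window `(t−a, t]` enters), the tagged pair contributes
`e^{−iπt/L'} τ_j`, `τ = −conj h` (crossed) / `1` (`rod_tagged_factor`), and
`∏_{j<k} s_j s_k = ∏_j s_j^{n−1}` (`prod_Ioi_mul_eq_prod_pow`), so each crossed spectator carries
`−conj(h)^n = −e^{−iπna/L'}`, cancelled by `σ`.

## References

* [ForresterEtAl2003] P. J. Forrester et al., Phys. Rev. A 67 (2003) 043607: §2.1.1 (the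
  Bose–Fermi sign trick).
* [MazzantiEtAl2008] F. Mazzanti et al., Phys. Rev. Lett. 100 (2008) 020401: Eqs. (2)–(3).
-/

noncomputable section

open MeasureTheory Finset Complex Matrix
open scoped BigOperators Real ComplexConjugate

namespace Literature.Barriers.AtomisticToContinuum.BoseGas

section Sign

variable {n : ℕ} {Lp a t : ℝ}

/-- The half rod phase `h = e^{iπa/L'}` (`h² = e(a)`). [folklore] -/
def halfPhase (Lp a : ℝ) : ℂ := cexp (↑(π * a / Lp) * I)

/-- `|h| = 1`. [folklore] -/
theorem norm_halfPhase (Lp a : ℝ) : ‖halfPhase Lp a‖ = 1 := norm_exp_ofReal_mul_I _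

/-- `h conj h = 1`. [folklore] -/
theorem halfPhase_mul_conj (Lp a : ℝ) : halfPhase Lp a * conj (halfPhase Lp a) = 1 := by
  rw [mul_conj_eq_norm_sq, norm_halfPhase]; simp

/-- `e(a) = h²`. [folklore] -/
theorem eL_eq_halfPhase_sq (Lp a : ℝ) : eL Lp a = halfPhase Lp a ^ 2 := by
  unfold eL halfPhase
  rw [sq, ← Complex.exp_add]
  congr 1; push_cast; ring

/-- The pair weight `s(u) = conj h` on crossed coordinates (`u ≤ t − a`), `1` otherwise.
[folklore] -/
def pairWeight (Lp a t u : ℝ) : ℂ := if u ≤ t - a then conj (halfPhase Lp a) else 1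

/-! #### Sign facts -/

/-- `sin(πs/L) ≥ 0` for `s ∈ [0, L]`. [folklore] -/
theorem sin_div_nonneg {L s : ℝ} (hL : 0 < L) (h0 : 0 ≤ s) (h1 : s ≤ L) :
    0 ≤ Real.sin (π * s / L) := by
  apply Real.sin_nonneg_of_nonneg_of_le_pi
  · positivity
  · rw [div_le_iff₀ hL]; nlinarith [Real.pi_pos]

/-- `sin(πs/L) ≤ 0` for `s ∈ [−L, 0]`. [folklore] -/
theorem sin_div_nonpos {L s : ℝ} (hL : 0 < L) (h0 : s ≤ 0) (h1 : -L ≤ s) :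
    Real.sin (π * s / L) ≤ 0 := by
  apply Real.sin_nonpos_of_nonpos_of_neg_pi_le
  · rw [div_nonpos_iff]; right; exact ⟨by nlinarith [Real.pi_pos], hL.le⟩
  · rw [le_div_iff₀ hL]; nlinarith [Real.pi_pos]

/-! #### The pair factor -/

/-- **Mixed pair.** For a crossed `x ∈ [0, t−a]` and an uncrossed `y ∈ (t, L']`:
`(e(y) − e(x)) conj(e(y) − e(x + a)) = conj(h) |e(y) − e(x)| |e(y) − e(x+a)|`
(both sines in Girardeau's identity are `≤ 0`: here the empty window is used). [folklore] -/
theorem rod_mixed_pair (hLp : 0 < Lp) (ha : 0 ≤ a) {x y : ℝ}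
    (hx : x ∈ Set.Icc 0 (t - a)) (hy : y ∈ Set.Ioc t Lp) :
    (eL Lp y - eL Lp x) * conj (eL Lp y - eL Lp (x + a)) =
      conj (halfPhase Lp a) * ((‖eL Lp y - eL Lp x‖ * ‖eL Lp y - eL Lp (x + a)‖ : ℝ) : ℂ) := by
  rw [eL_factor_identity Lp x (x + a) y, norm_eL_sub_eL, norm_eL_sub_eL]
  have hs1 : Real.sin (π * (x - y) / Lp) ≤ 0 :=
    sin_div_nonpos hLp (by linarith [hx.2, hy.1]) (by linarith [hx.1, hy.2])
  have hs2 : Real.sin (π * (x + a - y) / Lp) ≤ 0 :=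
    sin_div_nonpos hLp (by linarith [hx.2, hy.1]) (by linarith [hx.1, hy.2])
  have hconj : cexp (↑(π * (x - (x + a)) / Lp) * I) = conj (halfPhase Lp a) := by
    unfold halfPhase
    rw [← Complex.exp_conj]
    congr 1
    simp only [map_mul, Complex.conj_ofReal, Complex.conj_I]
    push_cast; ring
  rw [hconj, show π * (y - x) / Lp = -(π * (x - y) / Lp) by ring,
    show π * (y - (x + a)) / Lp = -(π * (x + a - y) / Lp) by ring, Real.sin_neg, Real.sin_neg,
    abs_neg, abs_neg, abs_of_nonpos hs1, abs_of_nonpos hs2]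
  push_cast
  ring

/-- **The pair factor.** For spectators `x ≠ y` in the compressed domain,
`(e(y) − e(x)) conj(e(T y) − e(T x)) = s(x) s(y) |e(y) − e(x)| |e(Ty) − e(Tx)|`. [folklore] -/
theorem rod_pair_factor (hLp : 0 < Lp) (ha : 0 ≤ a) {x y : ℝ}
    (hx : x ∈ rodDomain Lp a t) (hy : y ∈ rodDomain Lp a t) :
    (eL Lp y - eL Lp x) * conj (eL Lp (rodShift a t y) - eL Lp (rodShift a t x)) =
      pairWeight Lp a t x * pairWeight Lp a t y *
        ((‖eL Lp y - eL Lp x‖ * ‖eL Lp (rodShift a t y) - eL Lp (rodShift a t x)‖ : ℝ) : ℂ) := by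
  -- membership in the two pieces versus the crossing predicate
  have hmem : ∀ u : ℝ, u ∈ rodDomain Lp a t → (u ≤ t - a → u ∈ Set.Icc 0 (t - a)) ∧
      (¬ u ≤ t - a → u ∈ Set.Ioc t Lp) := by
    intro u hu
    rcases hu with hu | hu
    · exact ⟨fun _ => hu, fun h => absurd hu.2 h⟩
    · refine ⟨fun h => ?_, fun _ => hu⟩
      exfalso; linarith [hu.1]
  unfold pairWeight rodShift
  by_cases hxc : x ≤ t - a <;> by_cases hyc : y ≤ t - a
  · -- both crossed
    simp only [if_pos hxc, if_pos hyc]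
    have hfac : eL Lp (y + a) - eL Lp (x + a) = eL Lp a * (eL Lp y - eL Lp x) := by
      rw [eL_add, eL_add]; ring
    rw [hfac, map_mul, norm_mul, norm_eL, one_mul, ← mul_assoc, mul_comm (eL Lp y - eL Lp x),
      mul_assoc, mul_conj_eq_norm_sq, eL_eq_halfPhase_sq, map_pow]
    push_cast; ring
  · -- x crossed, y uncrossed
    simp only [if_pos hxc, if_neg hyc]
    rw [rod_mixed_pair hLp ha ((hmem x hx).1 hxc) ((hmem y hy).2 hyc)]
    ring
  · -- x uncrossed, y crossed
    simp only [if_neg hxc, if_pos hyc]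
    have h := rod_mixed_pair hLp ha ((hmem y hy).1 hyc) ((hmem x hx).2 hxc)
    have hflip : (eL Lp y - eL Lp x) * conj (eL Lp (y + a) - eL Lp x) =
        (eL Lp x - eL Lp y) * conj (eL Lp x - eL Lp (y + a)) := by
      rw [← neg_sub (eL Lp x) (eL Lp y), ← neg_sub (eL Lp x) (eL Lp (y + a)), map_neg]; ring
    rw [hflip, h, norm_sub_rev (eL Lp x) (eL Lp y), norm_sub_rev (eL Lp x) (eL Lp (y + a))]
    ring
  · -- both uncrossed
    simp only [if_neg hxc, if_neg hyc]
    rw [mul_conj_eq_norm_sq]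
    push_cast; ring

/-! #### Products over pairs -/

/-- `∏_{j<k} g_j g_k = ∏_i g_i^{n−1}` (each index lies in `n − 1` pairs). [folklore] -/
theorem prod_Ioi_mul_eq_prod_pow {M : Type*} [CommMonoid M] {m : ℕ} (g : Fin m → M) :
    ∏ i : Fin m, ∏ j ∈ Ioi i, (g i * g j) = ∏ i : Fin m, g i ^ (m - 1) := by
  simp_rw [Finset.prod_mul_distrib, Finset.prod_const]
  have hswap : ∏ i : Fin m, ∏ j ∈ Ioi i, g j = ∏ j : Fin m, ∏ _i ∈ Iio j, g j := by
    refine Finset.prod_comm' fun i j => ?_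
    simp only [Finset.mem_univ, true_and, and_true, Finset.mem_Ioi, Finset.mem_Iio]
  rw [hswap]
  simp_rw [Finset.prod_const, ← Finset.prod_mul_distrib, ← pow_add]
  refine Finset.prod_congr rfl fun i _ => ?_
  rw [Fin.card_Ioi, Fin.card_Iio]
  congr 1
  have := i.is_lt
  omega

/-- **Spectator Vandermondes.** `det V(e(w)) · conj det V(e(T w)) =
(∏_j s(w_j)^{n−1}) · |det V(e(w))| · |det V(e(Tw))|`. [folklore] -/
theorem rod_det_mul_conj_det (hLp : 0 < Lp) (ha : 0 ≤ a) (w : Fin n → ℝ)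
    (hw : ∀ j, w j ∈ rodDomain Lp a t) :
    det (vandermonde fun j => eL Lp (w j)) *
        conj (det (vandermonde fun j => eL Lp (rodShift a t (w j)))) =
      (∏ j, pairWeight Lp a t (w j) ^ (n - 1)) *
        ((‖det (vandermonde fun j => eL Lp (w j))‖ *
          ‖det (vandermonde fun j => eL Lp (rodShift a t (w j)))‖ : ℝ) : ℂ) := by
  set f : Fin n → Fin n → ℂ := fun i j => eL Lp (w j) - eL Lp (w i) with hf
  set fT : Fin n → Fin n → ℂ := fun i j => eL Lp (rodShift a t (w j)) - eL Lp (rodShift a t (w i))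
    with hfT
  have key : ∀ i j, f i j * conj (fT i j) = pairWeight Lp a t (w i) * pairWeight Lp a t (w j) *
      ((‖f i j‖ * ‖fT i j‖ : ℝ) : ℂ) := fun i j => rod_pair_factor hLp ha (hw i) (hw j)
  have hA : det (vandermonde fun j => eL Lp (w j)) = ∏ i, ∏ j ∈ Ioi i, f i j := det_vandermonde _
  have hAT : det (vandermonde fun j => eL Lp (rodShift a t (w j))) = ∏ i, ∏ j ∈ Ioi i, fT i j :=
    det_vandermonde _
  rw [hA, hAT]
  calc (∏ i, ∏ j ∈ Ioi i, f i j) * conj (∏ i, ∏ j ∈ Ioi i, fT i j)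
      = ∏ i, ∏ j ∈ Ioi i, (f i j * conj (fT i j)) := by
        rw [map_prod, ← Finset.prod_mul_distrib]
        refine Finset.prod_congr rfl fun i _ => ?_
        rw [map_prod, ← Finset.prod_mul_distrib]
    _ = ∏ i, ∏ j ∈ Ioi i, (pairWeight Lp a t (w i) * pairWeight Lp a t (w j) *
          ((‖f i j‖ : ℂ) * (‖fT i j‖ : ℂ))) := by
        refine Finset.prod_congr rfl fun i _ => Finset.prod_congr rfl fun j _ => ?_
        rw [key, Complex.ofReal_mul]
    _ = (∏ i, ∏ j ∈ Ioi i, (pairWeight Lp a t (w i) * pairWeight Lp a t (w j))) *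
          ((∏ i, ∏ j ∈ Ioi i, (‖f i j‖ : ℂ)) * ∏ i, ∏ j ∈ Ioi i, (‖fT i j‖ : ℂ)) := by
        simp only [Finset.prod_mul_distrib]
    _ = (∏ j, pairWeight Lp a t (w j) ^ (n - 1)) *
          ((‖∏ i, ∏ j ∈ Ioi i, f i j‖ * ‖∏ i, ∏ j ∈ Ioi i, fT i j‖ : ℝ) : ℂ) := by
        rw [prod_Ioi_mul_eq_prod_pow]
        congr 1
        simp only [norm_prod]
        push_cast
        rfl

/-! #### The tagged factors -/

/-- **Tagged factor.** `(e(w) − e(0)) conj(e(Tw) − e(t)) = e^{−iπt/L'} τ(w) |e(w) − e(0)||e(Tw) − e(t)|`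
with `τ = −conj h` on crossed and `τ = 1` on uncrossed spectators. [folklore] -/
theorem rod_tagged_factor (hLp : 0 < Lp) (ha : 0 ≤ a) (hat : a ≤ t) (htL : t ≤ Lp) {w : ℝ}
    (hw : w ∈ rodDomain Lp a t) :
    (eL Lp w - eL Lp 0) * conj (eL Lp (rodShift a t w) - eL Lp t) =
      cexp (-(↑(π * t / Lp) * I)) * (if w ≤ t - a then -conj (halfPhase Lp a) else 1) *
        ((‖eL Lp w - eL Lp 0‖ * ‖eL Lp (rodShift a t w) - eL Lp t‖ : ℝ) : ℂ) := by
  unfold rodShift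
  by_cases hc : w ≤ t - a
  · -- crossed: `w ∈ [0, t − a]`
    have hwI : w ∈ Set.Icc 0 (t - a) := by
      rcases hw with hw | hw
      · exact hw
      · exfalso; linarith [hw.1]
    simp only [if_pos hc]
    have hfac : eL Lp (w + a) - eL Lp t = eL Lp a * (eL Lp w - eL Lp (t - a)) := by
      rw [eL_add, show t = (t - a) + a by ring, eL_add]; ring
    rw [hfac, map_mul, ← mul_assoc, mul_comm (eL Lp w - eL Lp 0), mul_assoc,
      eL_factor_identity Lp 0 (t - a) w, norm_mul, norm_eL, one_mul, norm_eL_sub_eL,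
      norm_eL_sub_eL]
    have hs1 : Real.sin (π * (0 - w) / Lp) ≤ 0 :=
      sin_div_nonpos hLp (by linarith [hwI.1]) (by linarith [hwI.2, hat, htL])
    have hs2 : 0 ≤ Real.sin (π * (t - a - w) / Lp) :=
      sin_div_nonneg hLp (by linarith [hwI.2]) (by linarith [hwI.1, htL, ha])
    rw [show π * (w - 0) / Lp = -(π * (0 - w) / Lp) by ring, Real.sin_neg, abs_neg,
      show π * (w - (t - a)) / Lp = -(π * (t - a - w) / Lp) by ring, Real.sin_neg, abs_neg,
      abs_of_nonpos hs1, abs_of_nonneg hs2]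
    have hph : conj (eL Lp a) * cexp (↑(π * (0 - (t - a)) / Lp) * I) =
        cexp (-(↑(π * t / Lp) * I)) * conj (halfPhase Lp a) := by
      unfold eL halfPhase
      rw [← Complex.exp_conj, ← Complex.exp_conj, ← Complex.exp_add, ← Complex.exp_add]
      congr 1
      simp only [map_mul, Complex.conj_ofReal, Complex.conj_I]
      push_cast; ring
    calc conj (eL Lp a) * (4 * cexp (↑(π * (0 - (t - a)) / Lp) * I) *
          (↑(Real.sin (π * (0 - w) / Lp)) * ↑(Real.sin (π * (t - a - w) / Lp))))
        = (conj (eL Lp a) * cexp (↑(π * (0 - (t - a)) / Lp) * I)) *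
            (4 * (↑(Real.sin (π * (0 - w) / Lp)) * ↑(Real.sin (π * (t - a - w) / Lp)))) := by ring
      _ = cexp (-(↑(π * t / Lp) * I)) * conj (halfPhase Lp a) *
            (4 * (↑(Real.sin (π * (0 - w) / Lp)) * ↑(Real.sin (π * (t - a - w) / Lp)))) := by
          rw [hph]
      _ = _ := by push_cast; ring
  · -- uncrossed: `w ∈ (t, L']`
    have hwI : w ∈ Set.Ioc t Lp := by
      rcases hw with hw | hw
      · exact absurd hw.2 hc
      · exact hw
    simp only [if_neg hc]
    rw [eL_factor_identity Lp 0 t w, norm_eL_sub_eL, norm_eL_sub_eL]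
    have hs1 : Real.sin (π * (0 - w) / Lp) ≤ 0 :=
      sin_div_nonpos hLp (by linarith [hwI.1, ha, hat]) (by linarith [hwI.2])
    have hs2 : Real.sin (π * (t - w) / Lp) ≤ 0 :=
      sin_div_nonpos hLp (by linarith [hwI.1]) (by linarith [hwI.2, ha, hat])
    rw [show π * (w - 0) / Lp = -(π * (0 - w) / Lp) by ring, Real.sin_neg, abs_neg,
      show π * (w - t) / Lp = -(π * (t - w) / Lp) by ring, Real.sin_neg, abs_neg,
      abs_of_nonpos hs1, abs_of_nonpos hs2]
    have hph : cexp (↑(π * (0 - t) / Lp) * I) = cexp (-(↑(π * t / Lp) * I)) := by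
      congr 1; push_cast; ring
    rw [hph]
    push_cast; ring

/-- The crossed weights cancel: `σ(w) · τ(w) · s(w)^{n−1}·… = 1`, precisely
`σ(w) * (τ-part) * s(w)^(n) = …`; here in the form used below:
`rodWeight n w * (if crossed then −conj h else 1) * pairWeight w ^ n' = 1` when `n' + 1 = n + 1`…
— stated for `n` spectators: `σ_n(w) · τ(w) · s(w)^{n−1} = 1`. [folklore] -/
theorem rod_weights_cancel (n : ℕ) (Lp a t w : ℝ) (hn : 1 ≤ n) :
    rodWeight n Lp a t w * (if w ≤ t - a then -conj (halfPhase Lp a) else 1) *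
        pairWeight Lp a t w ^ (n - 1) = 1 := by
  unfold rodWeight pairWeight
  by_cases hc : w ≤ t - a
  · simp only [if_pos hc]
    have hh : cexp (↑(π * n * a / Lp) * I) = halfPhase Lp a ^ n := by
      unfold halfPhase
      rw [← Complex.exp_nat_mul]
      congr 1; push_cast; ring
    rw [hh, neg_mul_neg, mul_assoc, ← pow_succ', Nat.sub_add_cancel hn, ← mul_pow,
      halfPhase_mul_conj, one_pow]
  · simp only [if_neg hc, one_pow, mul_one]

/-- **Girardeau's sign trick with shifts (pointwise).** For spectators in the compressed domain,
`∏_j σ(w_j) det V(e(0), e(w)) conj det V(e(t), e(T w))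
 = e^{−iπnt/L'} (n+1)! L'^{n+1} Ψ_TG(w, 0) Ψ_TG(T w, t)` (rod version of Part D).
[cite: ForresterEtAl2003, §2.1.1] -/
theorem rod_sgn_det_det_eq_girardeau (hLp : 0 < Lp) (ha : 0 ≤ a) (hat : a ≤ t) (htL : t ≤ Lp)
    (w : Fin n → ℝ) (hw : ∀ j, w j ∈ rodDomain Lp a t) :
    (∏ j, rodWeight n Lp a t (w j)) *
        (det (vandermonde fun j => eL Lp ((Fin.cons 0 w : Fin (n + 1) → ℝ) j)) *
          conj (det (vandermonde fun j =>
            eL Lp ((Fin.cons t (fun i => rodShift a t (w i)) : Fin (n + 1) → ℝ) j)))) =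
      cexp (-(↑(π * t / Lp) * I)) ^ n * ((((n + 1).factorial : ℝ) * Lp ^ (n + 1) : ℝ) : ℂ) *
        ((girardeauState (n + 1) Lp (Fin.snoc w 0) *
          girardeauState (n + 1) Lp (Fin.snoc (fun i => rodShift a t (w i)) t) : ℝ) : ℂ) := by
  -- notation
  set Φ : ℂ := cexp (-(↑(π * t / Lp) * I)) with hΦ
  set Tw : Fin n → ℝ := fun i => rodShift a t (w i) with hTw
  set A : ℂ := det (vandermonde fun j => eL Lp (w j)) with hA
  set AT : ℂ := det (vandermonde fun j => eL Lp (Tw j)) with hAT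
  set P0 : ℂ := ∏ j, (eL Lp (w j) - eL Lp 0) with hP0
  set Pt : ℂ := ∏ j, (eL Lp (Tw j) - eL Lp t) with hPt
  set τ : Fin n → ℂ := fun j => if w j ≤ t - a then -conj (halfPhase Lp a) else 1 with hτ
  set s : Fin n → ℂ := fun j => pairWeight Lp a t (w j) with hs
  set n0 : Fin n → ℝ := fun j => ‖eL Lp (w j) - eL Lp 0‖ with hn0
  set nt : Fin n → ℝ := fun j => ‖eL Lp (Tw j) - eL Lp t‖ with hnt
  -- the cons-Vandermonde determinants
  have hdet0 : det (vandermonde fun j => eL Lp ((Fin.cons 0 w : Fin (n + 1) → ℝ) j)) = P0 * A := by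
    rw [eL_comp_cons, det_vandermonde_cons]
  have hdett : det (vandermonde fun j => eL Lp ((Fin.cons t Tw : Fin (n + 1) → ℝ) j)) = Pt * AT := by
    rw [eL_comp_cons, det_vandermonde_cons]
  -- tagged factors
  have htag : P0 * conj Pt = Φ ^ n * (∏ j, τ j) * ((∏ j, n0 j * nt j : ℝ) : ℂ) := by
    rw [hP0, hPt, map_prod, ← Finset.prod_mul_distrib, Complex.ofReal_prod]
    have hpt : ∀ j, (eL Lp (w j) - eL Lp 0) * conj (eL Lp (Tw j) - eL Lp t) =
        Φ * τ j * ((n0 j * nt j : ℝ) : ℂ) := fun j => rod_tagged_factor hLp ha hat htL (hw j)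
    simp_rw [hpt, Finset.prod_mul_distrib, Finset.prod_const, Finset.card_univ, Fintype.card_fin]
  -- spectator Vandermondes
  have hspec : A * conj AT = (∏ j, s j ^ (n - 1)) * ((‖A‖ * ‖AT‖ : ℝ) : ℂ) :=
    rod_det_mul_conj_det hLp ha w hw
  -- the Girardeau states
  have hC2 : (0 : ℝ) < ((n + 1).factorial : ℝ) * Lp ^ (n + 1) := by positivity
  have hgs0 : girardeauState (n + 1) Lp (Fin.snoc w 0) =
      (Real.sqrt (((n + 1).factorial : ℝ) * Lp ^ (n + 1)))⁻¹ * (‖P0‖ * ‖A‖) := by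
    rw [girardeauState_eq_norm_det, norm_det_vandermonde_snoc, hdet0, norm_mul]
  have hgst : girardeauState (n + 1) Lp (Fin.snoc Tw t) =
      (Real.sqrt (((n + 1).factorial : ℝ) * Lp ^ (n + 1)))⁻¹ * (‖Pt‖ * ‖AT‖) := by
    rw [girardeauState_eq_norm_det, norm_det_vandermonde_snoc, hdett, norm_mul]
  have hnorms : ‖P0‖ * ‖Pt‖ = ∏ j, n0 j * nt j := by
    rw [hP0, hPt, norm_prod, norm_prod, ← Finset.prod_mul_distrib]
  have hRHS : (((n + 1).factorial : ℝ) * Lp ^ (n + 1)) *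
      (girardeauState (n + 1) Lp (Fin.snoc w 0) * girardeauState (n + 1) Lp (Fin.snoc Tw t)) =
      (∏ j, n0 j * nt j) * (‖A‖ * ‖AT‖) := by
    rw [hgs0, hgst, ← hnorms]
    set C2 : ℝ := ((n + 1).factorial : ℝ) * Lp ^ (n + 1)
    have hsq : (Real.sqrt C2)⁻¹ * (Real.sqrt C2)⁻¹ = C2⁻¹ := by
      rw [← mul_inv, Real.mul_self_sqrt hC2.le]
    calc C2 * ((Real.sqrt C2)⁻¹ * (‖P0‖ * ‖A‖) * ((Real.sqrt C2)⁻¹ * (‖Pt‖ * ‖AT‖)))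
        = C2 * ((Real.sqrt C2)⁻¹ * (Real.sqrt C2)⁻¹) * (‖P0‖ * ‖Pt‖) * (‖A‖ * ‖AT‖) := by ring
      _ = (‖P0‖ * ‖Pt‖) * (‖A‖ * ‖AT‖) := by rw [hsq, mul_inv_cancel₀ hC2.ne', one_mul]
  -- the weights cancel
  have hn : n = 0 ∨ 1 ≤ n := by omega
  have hcancel : (∏ j, rodWeight n Lp a t (w j)) * (∏ j, τ j) * (∏ j, s j ^ (n - 1)) = 1 := by
    rw [← Finset.prod_mul_distrib, ← Finset.prod_mul_distrib]
    rcases hn with hn | hn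
    · subst hn; simp
    · exact Finset.prod_eq_one fun j _ => rod_weights_cancel n Lp a t (w j) hn
  -- assemble
  rw [hdet0, hdett, map_mul, mul_assoc (Φ ^ n), ← Complex.ofReal_mul, hRHS]
  calc (∏ j, rodWeight n Lp a t (w j)) * (P0 * A * (conj Pt * conj AT))
      = (∏ j, rodWeight n Lp a t (w j)) * ((P0 * conj Pt) * (A * conj AT)) := by ring
    _ = (∏ j, rodWeight n Lp a t (w j)) * ((Φ ^ n * (∏ j, τ j) * ((∏ j, n0 j * nt j : ℝ) : ℂ)) *
          ((∏ j, s j ^ (n - 1)) * ((‖A‖ * ‖AT‖ : ℝ) : ℂ))) := by rw [htag, hspec]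
    _ = Φ ^ n * ((∏ j, rodWeight n Lp a t (w j)) * (∏ j, τ j) * (∏ j, s j ^ (n - 1))) *
          (((∏ j, n0 j * nt j : ℝ) : ℂ) * ((‖A‖ * ‖AT‖ : ℝ) : ℂ)) := by ring
    _ = Φ ^ n * (((∏ j, n0 j * nt j) * (‖A‖ * ‖AT‖) : ℝ) : ℂ) := by
          rw [hcancel]; push_cast; ring

end Sign

end Literature.Barriers.AtomisticToContinuum.BoseGas

end
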